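import Mathlib
import Literature.GroupTheory.CombinatorialGroupTheory.SignedHurwitzAction
import Literature.GroupTheory.CombinatorialGroupTheory.SignedHurwitzStabilisation
import Literature.GroupTheory.CombinatorialGroupTheory.SignedHurwitzExchange
import HarnessLib
import Summits.SmoothPoincare4.SmoothPoincare4.Theorems.ConvexBisectionAcyclicBisectionRigidityStubMatsumotoNormalFormAux
import Summits.SmoothPoincare4.SmoothPoincare4.Theorems.ConvexBisectionAcyclicBisectionRigidityStubMatsumotoNormalFormAux7

/-!
# Normal forms with `|ω(u,w)| = 1`: the classes can be sign-normalised, II (`ω(u,w) = −1`)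

Helper file for stub D-alg (`stub_matsumotoNormalForm`) of line `folded-curve-branch-locus` of the
crux `ConvexBisection.AcyclicBisectionRigidity` (item stmt-SmoothPoincare4-10507).  Second half of
the sign normalisation (`Matsumoto.nf_signs_neg`, the sixteen cases with `ω(u,w) = −1`) and the
assembled statement `helper_normalForm_signs`: for `u' = ±u`, `w' = ±w` and `ω(u,w) = ±1` the word
`[(u,η),(u',¬η),(w,η'),(w',¬η')]` lies in the signed Hurwitz orbit of an exactly-signed normal form
`[(u₂,η),(u₂,¬η),(w₂,η'),(w₂,¬η')]` with `ω(u₂,w₂) = ±1`.  With it the genus-one rung can keep the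
exactly-signed normal form in its topological recognition stub (D-top) once `|ω(u,w)| = 1` is known
(D-det, stated for the normal form up to sign).

Everything is proved; Mathlib and the `SignedHurwitz` files only.
-/

set_option linter.dupNamespace false

namespace Summit.SmoothPoincare4.SmoothPoincare4.Theorems.AcyclicBisectionRigidity.FoldedCurveBranchLocus

open Literature.GroupTheory.CombinatorialGroupTheory.SignedHurwitz

namespace Matsumoto

/-- Sign normalisation of a normal form with `ω(u,w) = -1` (machine-found chains of at most six
signed Hurwitz moves). [folklore] -/
theorem nf_signs_neg (u w u' w' : Fin 1 ⊕ Fin 1 → ℤ) (η η' : Bool) (hu : u' = u ∨ u' = -u)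
    (hw : w' = w ∨ w' = -w) (hk : (stdSymp ℤ 1) u w = -1) :
    ∃ u₂ w₂ : Fin 1 ⊕ Fin 1 → ℤ, ((stdSymp ℤ 1) u₂ w₂ = 1 ∨ (stdSymp ℤ 1) u₂ w₂ = -1) ∧
      HurwitzOrbit (stdSymp ℤ 1) [(u, η), (u', !η), (w, η'), (w', !η')]
        [(u₂, η), (u₂, !η), (w₂, η'), (w₂, !η')] := by
  have hku : (stdSymp ℤ 1) w u = -(-1) := by rw [stdSymp_int_swap 1 w u, hk]
  rcases hu with hu | hu <;> rcases hw with hw | hw <;> subst u' <;> subst w' <;> cases η <;> cases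
      η'
  · -- u' = u, w' = w, η = false, η' = false: 0 move(s)
    exact ⟨u, w, Or.inr (by norm_num [map_add, map_sub, map_neg, hk, hku, stdSymp_int_self]),
      HurwitzOrbit.refl _ _⟩
  · -- u' = u, w' = w, η = false, η' = true: 0 move(s)
    exact ⟨u, w, Or.inr (by norm_num [map_add, map_sub, map_neg, hk, hku, stdSymp_int_self]),
      HurwitzOrbit.refl _ _⟩
  · -- u' = u, w' = w, η = true, η' = false: 0 move(s)
    exact ⟨u, w, Or.inr (by norm_num [map_add, map_sub, map_neg, hk, hku, stdSymp_int_self]),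
      HurwitzOrbit.refl _ _⟩
  · -- u' = u, w' = w, η = true, η' = true: 0 move(s)
    exact ⟨u, w, Or.inr (by norm_num [map_add, map_sub, map_neg, hk, hku, stdSymp_int_self]),
      HurwitzOrbit.refl _ _⟩
  · -- u' = u, w' = -w, η = false, η' = false: 3 move(s)
    exact ⟨u + w, -w, Or.inl (by norm_num [map_add, map_sub, map_neg, hk, hku, stdSymp_int_self]),
      (orbit_alt2 [(u, false)] [(-w, true)] (u, true) (w, false) (1) (u + w)
          (by norm_num [map_add, map_sub, map_neg, hk, hku, stdSymp_int_self])
          (by rw [sgn_false]; module)).trans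
        ((orbit_alt1 [] [(u + w, true), (-w, true)] (u, false) (w, false) (-1) (u + w)
          (by norm_num [map_add, map_sub, map_neg, hk, hku, stdSymp_int_self])
          (by rw [sgn_false]; module)).trans
        ((orbit_alt2 [(u + w, false)] [(-w, true)] (u, false) (u + w, true) (1) (-w)
          (by norm_num [map_add, map_sub, map_neg, hk, hku, stdSymp_int_self])
          (by rw [sgn_true]; module))))⟩
  · -- u' = u, w' = -w, η = false, η' = true: 3 move(s)
    exact ⟨u, -w, Or.inl (by norm_num [map_add, map_sub, map_neg, hk, hku, stdSymp_int_self]),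
      (orbit_alt2 [(u, false)] [(-w, false)] (u, true) (w, true) (1) (u - w)
          (by norm_num [map_add, map_sub, map_neg, hk, hku, stdSymp_int_self])
          (by rw [sgn_true]; module)).trans
        ((orbit_alt2 [(u, false)] [(-w, false)] (w, true) (u - w, true) (-1) (u)
          (by norm_num [map_add, map_sub, map_neg, hk, hku, stdSymp_int_self])
          (by rw [sgn_true]; module)).trans
        ((orbit_alt2 [(u, false)] [(-w, false)] (u - w, true) (u, true) (1) (-w)
          (by norm_num [map_add, map_sub, map_neg, hk, hku, stdSymp_int_self])
          (by rw [sgn_true]; module))))⟩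
  · -- u' = u, w' = -w, η = true, η' = false: 3 move(s)
    exact ⟨u, -w, Or.inl (by norm_num [map_add, map_sub, map_neg, hk, hku, stdSymp_int_self]),
      (orbit_alt1 [(u, true)] [(-w, true)] (u, false) (w, false) (-1) (u + w)
          (by norm_num [map_add, map_sub, map_neg, hk, hku, stdSymp_int_self])
          (by rw [sgn_false]; module)).trans
        ((orbit_alt1 [(u, true)] [(-w, true)] (u + w, false) (u, false) (1) (-w)
          (by norm_num [map_add, map_sub, map_neg, hk, hku, stdSymp_int_self])
          (by rw [sgn_false]; module)).trans
        ((orbit_alt1 [(u, true)] [(-w, true)] (-w, false) (u + w, false) (-1) (u)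
          (by norm_num [map_add, map_sub, map_neg, hk, hku, stdSymp_int_self])
          (by rw [sgn_false]; module))))⟩
  · -- u' = u, w' = -w, η = true, η' = true: 3 move(s)
    exact ⟨u + w, -w, Or.inl (by norm_num [map_add, map_sub, map_neg, hk, hku, stdSymp_int_self]),
      (orbit_alt1 [(u, true)] [(-w, false)] (u, false) (w, true) (-1) (u + w)
          (by norm_num [map_add, map_sub, map_neg, hk, hku, stdSymp_int_self])
          (by rw [sgn_false]; module)).trans
        ((orbit_alt2 [] [(u, false), (-w, false)] (u, true) (u + w, true) (1) (-w)
          (by norm_num [map_add, map_sub, map_neg, hk, hku, stdSymp_int_self])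
          (by rw [sgn_true]; module)).trans
        ((orbit_alt1 [(u + w, true)] [(-w, false)] (-w, true) (u, false) (-1) (u + w)
          (by norm_num [map_add, map_sub, map_neg, hk, hku, stdSymp_int_self])
          (by rw [sgn_true]; module))))⟩
  · -- u' = -u, w' = w, η = false, η' = false: 3 move(s)
    exact ⟨-u + w, w, Or.inl (by norm_num [map_add, map_sub, map_neg, hk, hku, stdSymp_int_self]),
      (orbit_alt1 [(u, false)] [(w, true)] (-u, true) (w, false) (1) (-u + w)
          (by norm_num [map_add, map_sub, map_neg, hk, hku, stdSymp_int_self])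
          (by rw [sgn_true]; module)).trans
        ((orbit_alt2 [] [(-u, true), (w, true)] (u, false) (-u + w, false) (1) (w)
          (by norm_num [map_add, map_sub, map_neg, hk, hku, stdSymp_int_self])
          (by rw [sgn_false]; module)).trans
        ((orbit_alt1 [(-u + w, false)] [(w, true)] (w, false) (-u, true) (-1) (-u + w)
          (by norm_num [map_add, map_sub, map_neg, hk, hku, stdSymp_int_self])
          (by rw [sgn_false]; module))))⟩
  · -- u' = -u, w' = w, η = false, η' = true: 3 move(s)
    exact ⟨u, w, Or.inr (by norm_num [map_add, map_sub, map_neg, hk, hku, stdSymp_int_self]),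
      (orbit_alt2 [(u, false)] [(w, false)] (-u, true) (w, true) (-1) (-u + w)
          (by norm_num [map_add, map_sub, map_neg, hk, hku, stdSymp_int_self])
          (by rw [sgn_true]; module)).trans
        ((orbit_alt2 [(u, false)] [(w, false)] (w, true) (-u + w, true) (1) (u)
          (by norm_num [map_add, map_sub, map_neg, hk, hku, stdSymp_int_self])
          (by rw [sgn_true]; module)).trans
        ((orbit_alt2 [(u, false)] [(w, false)] (-u + w, true) (u, true) (-1) (w)
          (by norm_num [map_add, map_sub, map_neg, hk, hku, stdSymp_int_self])
          (by rw [sgn_true]; module))))⟩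
  · -- u' = -u, w' = w, η = true, η' = false: 3 move(s)
    exact ⟨u, w, Or.inr (by norm_num [map_add, map_sub, map_neg, hk, hku, stdSymp_int_self]),
      (orbit_alt1 [(u, true)] [(w, true)] (-u, false) (w, false) (1) (u + w)
          (by norm_num [map_add, map_sub, map_neg, hk, hku, stdSymp_int_self])
          (by rw [sgn_false]; module)).trans
        ((orbit_alt1 [(u, true)] [(w, true)] (u + w, false) (-u, false) (-1) (w)
          (by norm_num [map_add, map_sub, map_neg, hk, hku, stdSymp_int_self])
          (by rw [sgn_false]; module)).trans
        ((orbit_alt1 [(u, true)] [(w, true)] (w, false) (u + w, false) (1) (u)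
          (by norm_num [map_add, map_sub, map_neg, hk, hku, stdSymp_int_self])
          (by rw [sgn_false]; module))))⟩
  · -- u' = -u, w' = w, η = true, η' = true: 3 move(s)
    exact ⟨-u + w, w, Or.inl (by norm_num [map_add, map_sub, map_neg, hk, hku, stdSymp_int_self]),
      (orbit_alt2 [(u, true)] [(w, false)] (-u, false) (w, true) (-1) (-u + w)
          (by norm_num [map_add, map_sub, map_neg, hk, hku, stdSymp_int_self])
          (by rw [sgn_true]; module)).trans
        ((orbit_alt1 [] [(-u + w, false), (w, false)] (u, true) (w, true) (-1) (-u + w)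
          (by norm_num [map_add, map_sub, map_neg, hk, hku, stdSymp_int_self])
          (by rw [sgn_true]; module)).trans
        ((orbit_alt2 [(-u + w, true)] [(w, false)] (u, true) (-u + w, false) (1) (w)
          (by norm_num [map_add, map_sub, map_neg, hk, hku, stdSymp_int_self])
          (by rw [sgn_false]; module))))⟩
  · -- u' = -u, w' = -w, η = false, η' = false: 6 move(s)
    exact ⟨-u + w, -w, Or.inr (by norm_num [map_add, map_sub, map_neg, hk, hku, stdSymp_int_self]),
      (orbit_alt1 [(u, false)] [(-w, true)] (-u, true) (w, false) (1) (-u + w)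
          (by norm_num [map_add, map_sub, map_neg, hk, hku, stdSymp_int_self])
          (by rw [sgn_true]; module)).trans
        ((orbit_alt2 [] [(-u, true), (-w, true)] (u, false) (-u + w, false) (1) (w)
          (by norm_num [map_add, map_sub, map_neg, hk, hku, stdSymp_int_self])
          (by rw [sgn_false]; module)).trans
        ((orbit_alt2 [] [(-u, true), (-w, true)] (-u + w, false) (w, false) (-1) (-u)
          (by norm_num [map_add, map_sub, map_neg, hk, hku, stdSymp_int_self])
          (by rw [sgn_false]; module)).trans
        ((orbit_alt2 [] [(-u, true), (-w, true)] (w, false) (-u, false) (1) (-u + w)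
          (by norm_num [map_add, map_sub, map_neg, hk, hku, stdSymp_int_self])
          (by rw [sgn_false]; module)).trans
        ((orbit_alt2 [] [(-u, true), (-w, true)] (-u, false) (-u + w, false) (-1) (-w)
          (by norm_num [map_add, map_sub, map_neg, hk, hku, stdSymp_int_self])
          (by rw [sgn_false]; module)).trans
        ((orbit_alt1 [(-u + w, false)] [(-w, true)] (-w, false) (-u, true) (1) (-u + w)
          (by norm_num [map_add, map_sub, map_neg, hk, hku, stdSymp_int_self])
          (by rw [sgn_false]; module)))))))⟩
  · -- u' = -u, w' = -w, η = false, η' = true: 6 move(s)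
    exact ⟨u - w, -w, Or.inl (by norm_num [map_add, map_sub, map_neg, hk, hku, stdSymp_int_self]),
      (orbit_alt1 [(u, false)] [(-w, false)] (-u, true) (w, true) (1) (-u + w)
          (by norm_num [map_add, map_sub, map_neg, hk, hku, stdSymp_int_self])
          (by rw [sgn_true]; module)).trans
        ((orbit_alt1 [(u, false)] [(-w, false)] (-u + w, true) (-u, true) (-1) (-w)
          (by norm_num [map_add, map_sub, map_neg, hk, hku, stdSymp_int_self])
          (by rw [sgn_true]; module)).trans
        ((orbit_alt2 [] [(-u + w, true), (-w, false)] (u, false) (-w, true) (-1) (u - w)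
          (by norm_num [map_add, map_sub, map_neg, hk, hku, stdSymp_int_self])
          (by rw [sgn_true]; module)).trans
        ((orbit_alt2 [] [(-u + w, true), (-w, false)] (-w, true) (u - w, false) (1) (u - w - w)
          (by norm_num [map_add, map_sub, map_neg, hk, hku, stdSymp_int_self])
          (by rw [sgn_false]; module)).trans
        ((orbit_alt1 [(u - w, false)] [(-w, false)] (u - w - w, true) (-u + w, true) (1) (-w)
          (by norm_num [map_add, map_sub, map_neg, hk, hku, stdSymp_int_self])
          (by rw [sgn_true]; module)).trans
        ((orbit_alt1 [(u - w, false)] [(-w, false)] (-w, true) (u - w - w, true) (-1) (u - w)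
          (by norm_num [map_add, map_sub, map_neg, hk, hku, stdSymp_int_self])
          (by rw [sgn_true]; module)))))))⟩
  · -- u' = -u, w' = -w, η = true, η' = false: 6 move(s)
    exact ⟨u + w, -w, Or.inl (by norm_num [map_add, map_sub, map_neg, hk, hku, stdSymp_int_self]),
      (orbit_alt1 [(u, true)] [(-w, true)] (-u, false) (w, false) (1) (u + w)
          (by norm_num [map_add, map_sub, map_neg, hk, hku, stdSymp_int_self])
          (by rw [sgn_false]; module)).trans
        ((orbit_alt1 [(u, true)] [(-w, true)] (u + w, false) (-u, false) (-1) (w)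
          (by norm_num [map_add, map_sub, map_neg, hk, hku, stdSymp_int_self])
          (by rw [sgn_false]; module)).trans
        ((orbit_alt2 [] [(u + w, false), (-w, true)] (u, true) (w, false) (1) (u + w)
          (by norm_num [map_add, map_sub, map_neg, hk, hku, stdSymp_int_self])
          (by rw [sgn_false]; module)).trans
        ((orbit_alt2 [] [(u + w, false), (-w, true)] (w, false) (u + w, true) (-1) (u + w + w)
          (by norm_num [map_add, map_sub, map_neg, hk, hku, stdSymp_int_self])
          (by rw [sgn_true]; module)).trans
        ((orbit_alt1 [(u + w, true)] [(-w, true)] (u + w + w, false) (u + w, false) (1) (-w)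
          (by norm_num [map_add, map_sub, map_neg, hk, hku, stdSymp_int_self])
          (by rw [sgn_false]; module)).trans
        ((orbit_alt1 [(u + w, true)] [(-w, true)] (-w, false) (u + w + w, false) (-1) (u + w)
          (by norm_num [map_add, map_sub, map_neg, hk, hku, stdSymp_int_self])
          (by rw [sgn_false]; module)))))))⟩
  · -- u' = -u, w' = -w, η = true, η' = true: 6 move(s)
    exact ⟨-u - w, -w, Or.inr (by norm_num [map_add, map_sub, map_neg, hk, hku, stdSymp_int_self]),
      (orbit_alt1 [(u, true)] [(-w, false)] (-u, false) (w, true) (1) (u + w)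
          (by norm_num [map_add, map_sub, map_neg, hk, hku, stdSymp_int_self])
          (by rw [sgn_false]; module)).trans
        ((orbit_alt2 [] [(-u, false), (-w, false)] (u, true) (u + w, true) (1) (-w)
          (by norm_num [map_add, map_sub, map_neg, hk, hku, stdSymp_int_self])
          (by rw [sgn_true]; module)).trans
        ((orbit_alt2 [] [(-u, false), (-w, false)] (u + w, true) (-w, true) (-1) (u)
          (by norm_num [map_add, map_sub, map_neg, hk, hku, stdSymp_int_self])
          (by rw [sgn_true]; module)).trans
        ((orbit_alt2 [] [(-u, false), (-w, false)] (-w, true) (u, true) (1) (-u - w)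
          (by norm_num [map_add, map_sub, map_neg, hk, hku, stdSymp_int_self])
          (by rw [sgn_true]; module)).trans
        ((orbit_alt2 [] [(-u, false), (-w, false)] (u, true) (-u - w, true) (-1) (-w)
          (by norm_num [map_add, map_sub, map_neg, hk, hku, stdSymp_int_self])
          (by rw [sgn_true]; module)).trans
        ((orbit_alt1 [(-u - w, true)] [(-w, false)] (-w, true) (-u, false) (1) (-u - w)
          (by norm_num [map_add, map_sub, map_neg, hk, hku, stdSymp_int_self])
          (by rw [sgn_true]; module)))))))⟩

end Matsumoto

open Matsumoto in
/-- **Sign normalisation of a genus-one normal form with `|ω(u,w)| = 1`.**  For `u' = ±u`,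
`w' = ±w` and `ω(u,w) = ±1`, the word `[(u,η),(u',¬η),(w,η'),(w',¬η')]` is in the signed Hurwitz
orbit of an exactly-signed normal form `[(u₂,η),(u₂,¬η),(w₂,η'),(w₂,¬η')]` with `ω(u₂,w₂) = ±1`
(explicit chains of at most six moves). [folklore] -/
theorem helper_normalForm_signs (u u' w w' : Fin 1 ⊕ Fin 1 → ℤ) (η η' : Bool)
    (hu : u' = u ∨ u' = -u) (hw : w' = w ∨ w' = -w)
    (hk : (stdSymp ℤ 1) u w = 1 ∨ (stdSymp ℤ 1) u w = -1) :
    ∃ u₂ w₂ : Fin 1 ⊕ Fin 1 → ℤ, ((stdSymp ℤ 1) u₂ w₂ = 1 ∨ (stdSymp ℤ 1) u₂ w₂ = -1) ∧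
      HurwitzOrbit (stdSymp ℤ 1) [(u, η), (u', !η), (w, η'), (w', !η')]
        [(u₂, η), (u₂, !η), (w₂, η'), (w₂, !η')] := by
  rcases hk with hk | hk
  · exact nf_signs_pos u w u' w' η η' hu hw hk
  · exact nf_signs_neg u w u' w' η η' hu hw hk

end Summit.SmoothPoincare4.SmoothPoincare4.Theorems.AcyclicBisectionRigidity.FoldedCurveBranchLocus
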